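import Literature.MathematicalPhysics.QuantumFieldTheory.Balaban1983to89.Node00.Record13SepMixed
import Literature.MathematicalPhysics.QuantumFieldTheory.Balaban1983to89.Node00.Record13CarriersSep

/-!
# NODE 00 (YM-PLAN Track A) — THE STAGE-13 CARRIER PINS AT THE v1.3 PROVISOS `Provisos₁₃SepMixed` (row P11 on print's separated sequences, partition-compatible
# runs AND print's (7)-regular data) TRANSPORT ALONG EVERY `X`-RE-BINDING AND EVERY PIN, the datum `datumOfRecord₁₃SepMixed` IS UP-SIDE (`rfl`), and the v1.3 record
# `IsRecordOfRecord₁₃CSepMixed` is presented at any re-bound ∕ [B10]-pinned ∕ [B13]-pinned ∕ X-pinned Stage-13 view — the rev-20 twin leaf of `Record13CarriersSep` §2–§3 under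
# node00-def-T's v1.3 token map `Provisos₁₃Sep ↦ Provisos₁₃SepMixed`, `datumOfRecord₁₃Sep ↦ datumOfRecord₁₃SepMixed`, `IsRecordOfRecord₁₃CSep ↦ IsRecordOfRecord₁₃CSepMixed`
# (seat `pub-ymgap-dag-n10-d` g8, the ₁₃ carriers' declarer of record — dag-lead WORDS-130 ∕ ROLL-CALL «n10-d — X-view carriers at Sep»; director-ym №142 ρ1-SEQUENCED)

NODE 00 RECORD MODULE at Stage 13, v1.3 vocabulary (node00-def-T's SIBLING MODULE `Node00/Record13SepMixed.lean` p511029 — the gate's 200 000-byte cap on `Record13.lean`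
forced §10 into its own leaf; DEPRECATE-AND-ADD per director-ym №142: NEW support
`suppOfRecord₁₃SepMixed θ p n s := {W | W ∈ suppOfRecord₁₃ … ∧ Sect2.SeqSeparated θ.ν.M₁ s ∧ Sect2.DataSmall7P … W}` (node00-def-P11's Literature-side twin of print's (7),
[Balaban1985Variational] p. 278, over `B15DeterminingSets.spliceAt`), FLAT `structure Stage13Params.Provisos₁₃SepMixed` (the ten rows of `Provisos₁₃Sep` verbatim, `bg` := def-R's
ranged `BgProvisoΛ` over the NEW support with the run guard `PartCompat₁₃`; plus the HYP-AUDIT-13 rows `hM : ∃ a, θ.τ9.M = F.L ^ a` and `hM₁ : θ.ν.M₁ ∣ θ.τ9.M` (director-ym №145∕№148) — θ-letters, they transport verbatim), one-way maps `Provisos₁₃Sep.toSepMixed` ∕ `Provisos₁₃.toSepMixed` ∕ `Provisos₁₃SepMixed.toCore`,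
datum `datumOfRecord₁₃SepMixed` (on the same core, `rfl` bridges), record predicate `IsRecordOfRecord₁₃CSepMixed` (+ `isRecordOfRecord₁₃CSepMixed_of_eq`,
`exists_world_isRecordOfRecord₁₃CSepMixed`); `Provisos₁₃Core` and every v1.2 name UNCHANGED).  THIS LEAF supplies, for the rev-20 consumers that bind worlds at PINNED Stage-13
views (dag-n24-c's K1 engine, dag-n08-c's ∕ dag-n12-d's storeys, dag-n22-e's layer B, this seat's N10 storeys, …), exactly the carrier-side faces they read at the v1.2 key in
`Record13CarriersSep` §2–§3: (i) `Provisos₁₃SepMixed.rebindX ∕ .pin<G>` for `<G>` ∈ {B10, Y, Z, W, B8, B12, B8Sub, B13, X3} — FIELD BY FIELD: the rows read `ν`, `τ9`, `ζ`, `ppSel`,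
`A₁`, `Rz`, `Zt`, `γ`, `gOfRecord₁₃`, `EOfRecord₁₃`, `wOfRecord₉`, `settingOfRecord₁₃`, `suppOfRecord₁₃SepMixed` (whose (7) clause reads the θ-level letters `θ.s2.cR`, `θ.ν`,
`gOfRecord₁₃ F N θ p` and the averaging of record), `UbgOfRecord₁₃`, `PartCompat₁₃` — never `res.X ∕ Y ∕ Z ∕ W`; (ii) `datumOfRecord₁₃SepMixed_rebindX ∕ _pin<G>` — ALL `rfl`: THE
PINS ARE UP-SIDE at the v1.3 datum exactly as at the v1.1 ∕ v1.2 datums; (iii) the v1.3 record at a re-bound view: `isRecordOfRecord₁₃CSepMixed_rebindX_of_eq ∕ _pinB10_of_eq ∕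
_pinB13_of_eq ∕ _pinX3_of_eq`, `exists_world_isRecordOfRecord₁₃CSepMixed_rebindX ∕ _pinX3`, and the bridge `isRecordOfRecord₁₃CSepMixed_rebindX_of_eq_toSepMixed` (a v1.2-keyed `h`
read along `Provisos₁₃Sep.toSepMixed`).  The bg-free CORE faces (`Provisos₁₃Core.rebindX ∕ .pin<G>`, `datumOfRecord₁₃Core_*`) are `Record13CarriersSep` §1's and are NOT
re-declared (№142: «`Provisos₁₃Core` untouched»).  The [B8″] pin `Stage13Params.pinB8SubB` (dag-n05-d `Record13CarriersB8SubB`) is an instance of `rebindX` — its named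
`SepMixed` faces are one line each through `Provisos₁₃SepMixed.rebindX` ∕ `datumOfRecord₁₃SepMixed_rebindX`, declared on ask.  APPEND-ONLY: a NEW importing leaf
(`Record13SepMixed` ⊇ `Record13`; `Record13CarriersSep` ⊇ `…XPinned` ⊇ `…B13` ⊇ `Record13Carriers` ⊇ `Record13`); NOTHING in those files is edited; the v1.1- ∕ v1.2-keyed faces stand verbatim for the asides.
PRE-STAGED against def-T's desk draft §10 (`Record13.v1.3-DRAFT-STANDIN.NOT-TO-FILE.lean` 4f16ad48af9cb1c0, stand-in for (7)) in a concat scratch — farm rc 0 — and re-checked by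
import on the landed v1.3.  [Balaban1988Convergent] = Commun. Math. Phys. **119** (1988) 243–285; [Balaban1989LargeFieldII] = Commun. Math. Phys. **122** (1989) 355–392;
[Balaban1985Variational] = Commun. Math. Phys. **102** (1985) 277–309.

HONEST FRAMING: kernel bookkeeping (structure-instance re-keying and `rfl`); NO estimate; nothing of Bałaban's asserted; the provisos are HYPOTHESIS-SIDE structures, never
admissibility clauses, never inhabited here; no node discharged; counts unmoved (typed 28∕28 · discharged 5∕27); one finite T⁴ programme at fixed ε — NOT continuum ∕ ℝ⁴ ∕ OS ∕
mass gap ∕ Clay.  No `sorry`, no `axiom`, no `def`, no `instance`, no `notation`.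
-/

noncomputable section

namespace Literature.MathematicalPhysics.QuantumFieldTheory.Balaban1983to89.Node00

open T4Continuum AveragingRT T4FiniteEpsInhabited FlowStep FlowStepRuns DagBinding T4DatumAssembly
open scoped Matrix.Norms.L2Operator

variable {F : T4Family} {N : ℕ} [NeZero N]

/-! ## §1. The MIXED-RANGE provisos (row P11 on print's sequences with (7)-regular data, v1.3) transport along every X-re-binding and every pin; their datum is UP-SIDE -/

section SepMixed

/-- **The v1.3 mixed-range provisos read no carrier**: they transport along ANY `X`-re-binding (ten rows, field by field; row `bg` reads `γ`, `gOfRecord₁₃`,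
`PartCompat₁₃`, `settingOfRecord₁₃`, `Rz`, `τ9`, `suppOfRecord₁₃SepMixed`, `UbgOfRecord₁₃` — never `res.X`). [cite: Balaban1988Convergent, (2.18) p.257, (2.23)–(2.42) pp.259–262, (3.2)–(3.9) pp.265–266; Balaban1985RegularSpaces, (1.3)–(1.6) p.77 (bookkeeping)] -/
theorem Stage13Params.Provisos₁₃SepMixed.rebindX {θ : Stage13Params F N} (h : θ.Provisos₁₃SepMixed F N) (X' : B12.RunParams → PrintedCarriersR) :
    (θ.rebindX F N X').Provisos₁₃SepMixed F N :=
  { intPiece := h.intPiece, measω := h.measω, measChi := h.measChi, zetaUnity := h.zetaUnity, zetaAbs := h.zetaAbs, rstep := h.rstep, rzLaws := h.rzLaws,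
    ztLaws := h.ztLaws, ztLocal := h.ztLocal, hM := h.hM, hM₁ := h.hM₁, bg := h.bg }

/-- … along the [B10] pin … [cite: Balaban1988Convergent, (2.23)–(2.42) pp.259–262 (bookkeeping)] -/
theorem Stage13Params.Provisos₁₃SepMixed.pinB10 {θ : Stage13Params F N} (h : θ.Provisos₁₃SepMixed F N) : (θ.pinB10 F N).Provisos₁₃SepMixed F N :=
  h.rebindX _

/-- … the Y pin … [cite: Balaban1988Convergent, (2.23)–(2.42) pp.259–262 (bookkeeping)] -/
theorem Stage13Params.Provisos₁₃SepMixed.pinY {θ : Stage13Params F N} (h : θ.Provisos₁₃SepMixed F N) (Y₀ : PrintedCarriers9X) : (θ.pinY F N Y₀).Provisos₁₃SepMixed F N :=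
  { intPiece := h.intPiece, measω := h.measω, measChi := h.measChi, zetaUnity := h.zetaUnity, zetaAbs := h.zetaAbs, rstep := h.rstep, rzLaws := h.rzLaws,
    ztLaws := h.ztLaws, ztLocal := h.ztLocal, hM := h.hM, hM₁ := h.hM₁, bg := h.bg }

/-- … the Z pin … [cite: Balaban1988Convergent, (2.23)–(2.42) pp.259–262 (bookkeeping)] -/
theorem Stage13Params.Provisos₁₃SepMixed.pinZ {θ : Stage13Params F N} (h : θ.Provisos₁₃SepMixed F N) (Z₀ : PrintedCarriers11) : (θ.pinZ F N Z₀).Provisos₁₃SepMixed F N :=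
  { intPiece := h.intPiece, measω := h.measω, measChi := h.measChi, zetaUnity := h.zetaUnity, zetaAbs := h.zetaAbs, rstep := h.rstep, rzLaws := h.rzLaws,
    ztLaws := h.ztLaws, ztLocal := h.ztLocal, hM := h.hM, hM₁ := h.hM₁, bg := h.bg }

/-- … the W pin … [cite: Balaban1988Convergent, (2.23)–(2.42) pp.259–262 (bookkeeping)] -/
theorem Stage13Params.Provisos₁₃SepMixed.pinW {θ : Stage13Params F N} (h : θ.Provisos₁₃SepMixed F N) (W₀ : B12.RunParams → PrintedCarriers15) :
    (θ.pinW F N W₀).Provisos₁₃SepMixed F N :=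
  { intPiece := h.intPiece, measω := h.measω, measChi := h.measChi, zetaUnity := h.zetaUnity, zetaAbs := h.zetaAbs, rstep := h.rstep, rzLaws := h.rzLaws,
    ztLaws := h.ztLaws, ztLocal := h.ztLocal, hM := h.hM, hM₁ := h.hM₁, bg := h.bg }

/-- … the [B8] pin … [cite: Balaban1988Convergent, (2.23)–(2.42) pp.259–262 (bookkeeping)] -/
theorem Stage13Params.Provisos₁₃SepMixed.pinB8 {θ : Stage13Params F N} (h : θ.Provisos₁₃SepMixed F N) (lam : ResidB8 θ.toStage3Params) : (θ.pinB8 F N lam).Provisos₁₃SepMixed F N :=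
  h.rebindX _

/-- … the [B12] pin … [cite: Balaban1988Convergent, (2.23)–(2.42) pp.259–262 (bookkeeping)] -/
theorem Stage13Params.Provisos₁₃SepMixed.pinB12 {θ : Stage13Params F N} (h : θ.Provisos₁₃SepMixed F N) (lam : ResidB12 F N θ.τ9.M) : (θ.pinB12 F N lam).Provisos₁₃SepMixed F N :=
  h.rebindX _

/-- … the [B8′] pin … [cite: Balaban1988Convergent, (2.23)–(2.42) pp.259–262 (bookkeeping)] -/
theorem Stage13Params.Provisos₁₃SepMixed.pinB8Sub {θ : Stage13Params F N} (h : θ.Provisos₁₃SepMixed F N) (lam : ResidB8 θ.toStage3Params) : (θ.pinB8Sub F N lam).Provisos₁₃SepMixed F N :=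
  h.rebindX _

/-- … the [B13] pin … [cite: Balaban1988Convergent, (2.23)–(2.42) pp.259–262; Balaban1988RG2Cluster, Lemmas 1–3 pp.9–20 (bookkeeping)] -/
theorem Stage13Params.Provisos₁₃SepMixed.pinB13 {θ : Stage13Params F N} (h : θ.Provisos₁₃SepMixed F N) (lam : B12.RunParams → ResidB13 θ.toStage3Params) :
    (θ.pinB13 F N lam).Provisos₁₃SepMixed F N :=
  h.rebindX _

/-- … and the one-level X-pin of the three carrier groups of record. [cite: Balaban1988Convergent, (2.23)–(2.42) pp.259–262 (bookkeeping)] -/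
theorem Stage13Params.Provisos₁₃SepMixed.pinX3 {θ : Stage13Params F N} (h : θ.Provisos₁₃SepMixed F N) (lam8 : ResidB8 θ.toStage3Params) (lam12 : ResidB12 F N θ.τ9.M)
    (lam13 : B12.RunParams → ResidB13 θ.toStage3Params) : (θ.pinX3 F N lam8 lam12 lam13).Provisos₁₃SepMixed F N :=
  h.rebindX _

variable (F N)

/-- **THE MIXED-RANGE DATUM DOES NOT READ THE CARRIER BUNDLE `X`** (`rfl`, once, at a generic re-binding). [cite: Balaban1989LargeFieldII, Thm 1 + (0.1) pp.355–356 (bookkeeping)] -/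
theorem datumOfRecord₁₃SepMixed_rebindX (θ : Stage13Params F N) (h : θ.Provisos₁₃SepMixed F N) (X' : B12.RunParams → PrintedCarriersR)
    (h' : (θ.rebindX F N X').Provisos₁₃SepMixed F N) : datumOfRecord₁₃SepMixed F N (θ.rebindX F N X') h' = datumOfRecord₁₃SepMixed F N θ h := rfl

/-- **THE PINS ARE UP-SIDE at the v1.3 datum**: the [B10] pin (`rfl`) … [cite: Balaban1989LargeFieldII, Thm 1 + (0.1) pp.355–356; Balaban1985UV3, Thm 1 p.257 (bookkeeping)] -/
theorem datumOfRecord₁₃SepMixed_pinB10 (θ : Stage13Params F N) (h : θ.Provisos₁₃SepMixed F N) :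
    datumOfRecord₁₃SepMixed F N (θ.pinB10 F N) h.pinB10 = datumOfRecord₁₃SepMixed F N θ h :=
  datumOfRecord₁₃SepMixed_rebindX F N θ h _ h.pinB10

/-- … the Y pin (`rfl`) … [cite: Balaban1989LargeFieldII, Thm 1 + (0.1) pp.355–356 (bookkeeping)] -/
theorem datumOfRecord₁₃SepMixed_pinY (θ : Stage13Params F N) (h : θ.Provisos₁₃SepMixed F N) (Y₀ : PrintedCarriers9X) :
    datumOfRecord₁₃SepMixed F N (θ.pinY F N Y₀) (h.pinY Y₀) = datumOfRecord₁₃SepMixed F N θ h := rfl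

/-- … the Z pin (`rfl`) … [cite: Balaban1989LargeFieldII, Thm 1 + (0.1) pp.355–356 (bookkeeping)] -/
theorem datumOfRecord₁₃SepMixed_pinZ (θ : Stage13Params F N) (h : θ.Provisos₁₃SepMixed F N) (Z₀ : PrintedCarriers11) :
    datumOfRecord₁₃SepMixed F N (θ.pinZ F N Z₀) (h.pinZ Z₀) = datumOfRecord₁₃SepMixed F N θ h := rfl

/-- … the W pin (`rfl`) … [cite: Balaban1989LargeFieldII, Thm 1 + (0.1) pp.355–356 (bookkeeping)] -/
theorem datumOfRecord₁₃SepMixed_pinW (θ : Stage13Params F N) (h : θ.Provisos₁₃SepMixed F N) (W₀ : B12.RunParams → PrintedCarriers15) :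
    datumOfRecord₁₃SepMixed F N (θ.pinW F N W₀) (h.pinW W₀) = datumOfRecord₁₃SepMixed F N θ h := rfl

/-- … the [B8] pin (`rfl`) … [cite: Balaban1989LargeFieldII, Thm 1 + (0.1) pp.355–356 (bookkeeping)] -/
theorem datumOfRecord₁₃SepMixed_pinB8 (θ : Stage13Params F N) (h : θ.Provisos₁₃SepMixed F N) (lam : ResidB8 θ.toStage3Params) :
    datumOfRecord₁₃SepMixed F N (θ.pinB8 F N lam) (h.pinB8 lam) = datumOfRecord₁₃SepMixed F N θ h :=
  datumOfRecord₁₃SepMixed_rebindX F N θ h _ (h.pinB8 lam)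

/-- … the [B12] pin (`rfl`) … [cite: Balaban1989LargeFieldII, Thm 1 + (0.1) pp.355–356 (bookkeeping)] -/
theorem datumOfRecord₁₃SepMixed_pinB12 (θ : Stage13Params F N) (h : θ.Provisos₁₃SepMixed F N) (lam : ResidB12 F N θ.τ9.M) :
    datumOfRecord₁₃SepMixed F N (θ.pinB12 F N lam) (h.pinB12 lam) = datumOfRecord₁₃SepMixed F N θ h :=
  datumOfRecord₁₃SepMixed_rebindX F N θ h _ (h.pinB12 lam)

/-- … the [B8′] pin (`rfl`) … [cite: Balaban1989LargeFieldII, Thm 1 + (0.1) pp.355–356 (bookkeeping)] -/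
theorem datumOfRecord₁₃SepMixed_pinB8Sub (θ : Stage13Params F N) (h : θ.Provisos₁₃SepMixed F N) (lam : ResidB8 θ.toStage3Params) :
    datumOfRecord₁₃SepMixed F N (θ.pinB8Sub F N lam) (h.pinB8Sub lam) = datumOfRecord₁₃SepMixed F N θ h :=
  datumOfRecord₁₃SepMixed_rebindX F N θ h _ (h.pinB8Sub lam)

/-- … the [B13] pin (`rfl`) … [cite: Balaban1989LargeFieldII, Thm 1 + (0.1) pp.355–356; Balaban1988RG2Cluster, Lemmas 1–3 pp.9–20 (bookkeeping)] -/
theorem datumOfRecord₁₃SepMixed_pinB13 (θ : Stage13Params F N) (h : θ.Provisos₁₃SepMixed F N) (lam : B12.RunParams → ResidB13 θ.toStage3Params) :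
    datumOfRecord₁₃SepMixed F N (θ.pinB13 F N lam) (h.pinB13 lam) = datumOfRecord₁₃SepMixed F N θ h :=
  datumOfRecord₁₃SepMixed_rebindX F N θ h _ (h.pinB13 lam)

/-- … and the one-level X-pin (`rfl`). [cite: Balaban1989LargeFieldII, Thm 1 + (0.1) pp.355–356 (bookkeeping)] -/
theorem datumOfRecord₁₃SepMixed_pinX3 (θ : Stage13Params F N) (h : θ.Provisos₁₃SepMixed F N) (lam8 : ResidB8 θ.toStage3Params) (lam12 : ResidB12 F N θ.τ9.M)
    (lam13 : B12.RunParams → ResidB13 θ.toStage3Params) :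
    datumOfRecord₁₃SepMixed F N (θ.pinX3 F N lam8 lam12 lam13) (h.pinX3 lam8 lam12 lam13) = datumOfRecord₁₃SepMixed F N θ h :=
  datumOfRecord₁₃SepMixed_rebindX F N θ h _ (h.pinX3 lam8 lam12 lam13)

end SepMixed

/-! ## §2. The v1.3 record `IsRecordOfRecord₁₃CSepMixed` presented at a re-bound ∕ pinned Stage-13 view (same datum, `datumOfRecord₁₃SepMixed_rebindX`) -/

section Records

variable (F N)

/-- **Pointed form, generic re-binding, v1.3 vocabulary**: a world with def-T's pointed clauses — construction `(datumOfRecord₁₃SepMixed θ h).C`, window `0 < w.γ ≤ θ.γ`, block size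
`θ.L` — whose upstream blocks are the C-binding over the Stage-13 view of the RE-BOUND parameters IS a v1.3 ₁₃C record at `datumOfRecord₁₃SepMixed θ h` (presenting parameter
`θ.rebindX X'`). [cite: Balaban1989LargeFieldII, Thm 1 + (0.1) pp.355–356 (bookkeeping)] -/
theorem isRecordOfRecord₁₃CSepMixed_rebindX_of_eq (θ : Stage13Params F N) (h : θ.Provisos₁₃SepMixed F N) (hθ : θ.Admissible F N) (X' : B12.RunParams → PrintedCarriersR)
    (w : WorldP) (hC : w.C = (datumOfRecord₁₃SepMixed F N θ h).C) (hγ : 0 < w.γ ∧ w.γ ≤ θ.γ) (hL : w.L = (θ.L : ℝ))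
    (hup : ∀ P, w.up P = upOfRecord₅C F N ((θ.rebindX F N X').toStage5₁₃ F N) P) :
    IsRecordOfRecord₁₃CSepMixed F N (datumOfRecord₁₃SepMixed F N θ h) w :=
  ⟨θ.rebindX F N X', h.rebindX X', (Stage13Params.rebindX_admissible_iff F N θ X').2 hθ, (datumOfRecord₁₃SepMixed_rebindX F N θ h X' (h.rebindX X')).symm,
    hC, hγ, hL, hup⟩

/-- **EVERY admissible Stage-13 parameter with the v1.3 provisos presents a v1.3 ₁₃C record at its own datum whose world is bound over ANY re-bound Stage-13 view**, any
window `0 < γw ≤ θ.γ`, block size `θ.L`. [cite: Balaban1989LargeFieldII, Thm 1 + (0.1) pp.355–356 (bookkeeping)] -/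
theorem exists_world_isRecordOfRecord₁₃CSepMixed_rebindX (θ : Stage13Params F N) (h : θ.Provisos₁₃SepMixed F N) (hθ : θ.Admissible F N) (X' : B12.RunParams → PrintedCarriersR)
    {γw : ℝ} (hγw : 0 < γw ∧ γw ≤ θ.γ) :
    ∃ w : WorldP, IsRecordOfRecord₁₃CSepMixed F N (datumOfRecord₁₃SepMixed F N θ h) w ∧ w.γ = γw ∧ w.L = (θ.L : ℝ) ∧
      ∀ P, w.up P = upOfRecord₅C F N ((θ.rebindX F N X').toStage5₁₃ F N) P := by
  obtain ⟨w₀⟩ := nonempty_worldP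
  exact ⟨{ w₀ with
      C := (datumOfRecord₁₃SepMixed F N θ h).C, γ := γw, L := (θ.L : ℝ), one_lt_L := by exact_mod_cast θ.hL.2,
      up := fun P => upOfRecord₅C F N ((θ.rebindX F N X').toStage5₁₃ F N) P },
    isRecordOfRecord₁₃CSepMixed_rebindX_of_eq F N θ h hθ X' _ rfl hγw rfl (fun _ => rfl), rfl, rfl, fun _ => rfl⟩

/-- The [B10] instance (dag-n08-c's N08 ₁₃ storeys read it by name). [cite: Balaban1989LargeFieldII, Thm 1 + (0.1) pp.355–356; Balaban1985UV3, Thm 1 p.257 (bookkeeping)] -/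
theorem isRecordOfRecord₁₃CSepMixed_pinB10_of_eq (θ : Stage13Params F N) (h : θ.Provisos₁₃SepMixed F N) (hθ : θ.Admissible F N)
    (w : WorldP) (hC : w.C = (datumOfRecord₁₃SepMixed F N θ h).C) (hγ : 0 < w.γ ∧ w.γ ≤ θ.γ) (hL : w.L = (θ.L : ℝ))
    (hup : ∀ P, w.up P = upOfRecord₅C F N ((θ.pinB10 F N).toStage5₁₃ F N) P) :
    IsRecordOfRecord₁₃CSepMixed F N (datumOfRecord₁₃SepMixed F N θ h) w :=
  isRecordOfRecord₁₃CSepMixed_rebindX_of_eq F N θ h hθ _ w hC hγ hL hup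

/-- The [B13] instance (this seat's N10 ₁₃ storeys read it by name). [cite: Balaban1989LargeFieldII, Thm 1 + (0.1) pp.355–356; Balaban1988RG2Cluster, Lemmas 1–3 pp.9–20 (bookkeeping)] -/
theorem isRecordOfRecord₁₃CSepMixed_pinB13_of_eq (θ : Stage13Params F N) (h : θ.Provisos₁₃SepMixed F N) (hθ : θ.Admissible F N)
    (lam : B12.RunParams → ResidB13 θ.toStage3Params) (w : WorldP) (hC : w.C = (datumOfRecord₁₃SepMixed F N θ h).C) (hγ : 0 < w.γ ∧ w.γ ≤ θ.γ) (hL : w.L = (θ.L : ℝ))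
    (hup : ∀ P, w.up P = upOfRecord₅C F N ((θ.pinB13 F N lam).toStage5₁₃ F N) P) :
    IsRecordOfRecord₁₃CSepMixed F N (datumOfRecord₁₃SepMixed F N θ h) w :=
  isRecordOfRecord₁₃CSepMixed_rebindX_of_eq F N θ h hθ _ w hC hγ hL hup

/-- The X-pinned instance (dag-n24-c's K1 engine closers read it by name). [cite: Balaban1989LargeFieldII, Thm 1 + (0.1) pp.355–356 (bookkeeping)] -/
theorem isRecordOfRecord₁₃CSepMixed_pinX3_of_eq (θ : Stage13Params F N) (h : θ.Provisos₁₃SepMixed F N) (hθ : θ.Admissible F N) (lam8 : ResidB8 θ.toStage3Params)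
    (lam12 : ResidB12 F N θ.τ9.M) (lam13 : B12.RunParams → ResidB13 θ.toStage3Params) (w : WorldP) (hC : w.C = (datumOfRecord₁₃SepMixed F N θ h).C)
    (hγ : 0 < w.γ ∧ w.γ ≤ θ.γ) (hL : w.L = (θ.L : ℝ)) (hup : ∀ P, w.up P = upOfRecord₅C F N ((θ.pinX3 F N lam8 lam12 lam13).toStage5₁₃ F N) P) :
    IsRecordOfRecord₁₃CSepMixed F N (datumOfRecord₁₃SepMixed F N θ h) w :=
  isRecordOfRecord₁₃CSepMixed_rebindX_of_eq F N θ h hθ _ w hC hγ hL hup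

/-- Every admissible Stage-13 parameter with the v1.3 provisos presents a v1.3 ₁₃C record of its own datum over the X-pinned Stage-13 view, any window `0 < γw ≤ θ.γ`,
block size `θ.L`. [cite: Balaban1989LargeFieldII, Thm 1 + (0.1) pp.355–356 (bookkeeping)] -/
theorem exists_world_isRecordOfRecord₁₃CSepMixed_pinX3 (θ : Stage13Params F N) (h : θ.Provisos₁₃SepMixed F N) (hθ : θ.Admissible F N) (lam8 : ResidB8 θ.toStage3Params)
    (lam12 : ResidB12 F N θ.τ9.M) (lam13 : B12.RunParams → ResidB13 θ.toStage3Params) {γw : ℝ} (hγw : 0 < γw ∧ γw ≤ θ.γ) :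
    ∃ w : WorldP, IsRecordOfRecord₁₃CSepMixed F N (datumOfRecord₁₃SepMixed F N θ h) w ∧ w.γ = γw ∧ w.L = (θ.L : ℝ) ∧
      ∀ P, w.up P = upOfRecord₅C F N ((θ.pinX3 F N lam8 lam12 lam13).toStage5₁₃ F N) P :=
  exists_world_isRecordOfRecord₁₃CSepMixed_rebindX F N θ h hθ _ hγw

/-- **Every v1.2-keyed presentation is a v1.3 one along `Provisos₁₃Sep.toSepMixed`** (same core datum): the ⁗-keyed re-bound record lemma of `Record13CarriersSep` §3 read in the
v1.3 vocabulary. [cite: Balaban1989LargeFieldII, Thm 1 + (0.1) pp.355–356 (bookkeeping)] -/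
theorem isRecordOfRecord₁₃CSepMixed_rebindX_of_eq_toSepMixed (θ : Stage13Params F N) (h : θ.Provisos₁₃Sep F N)
    (hM : ∃ a : ℕ, θ.τ9.M = F.L ^ a) (hM₁ : θ.ν.M₁ ∣ θ.τ9.M) (hθ : θ.Admissible F N) (X' : B12.RunParams → PrintedCarriersR)
    (w : WorldP) (hC : w.C = (datumOfRecord₁₃Sep F N θ h).C) (hγ : 0 < w.γ ∧ w.γ ≤ θ.γ) (hL : w.L = (θ.L : ℝ))
    (hup : ∀ P, w.up P = upOfRecord₅C F N ((θ.rebindX F N X').toStage5₁₃ F N) P) :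
    IsRecordOfRecord₁₃CSepMixed F N (datumOfRecord₁₃SepMixed F N θ (h.toSepMixed hM hM₁)) w :=
  isRecordOfRecord₁₃CSepMixed_rebindX_of_eq F N θ (h.toSepMixed hM hM₁) hθ X' w hC hγ hL hup

end Records

end Literature.MathematicalPhysics.QuantumFieldTheory.Balaban1983to89.Node00

end
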